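import Literature.MathematicalPhysics.QuantumFieldTheory.Balaban1983to89.B8LeafKnitRS
import Literature.MathematicalPhysics.QuantumFieldTheory.Balaban1983to89.B8Ineq145

/-!
# `Balaban1983to89.B8LeafKnitRSC` — T. Bałaban, *Spaces of regular gauge field configurations on a lattice and gauge fixing
# conditions*, Commun. Math. Phys. **99** (1985) 75–102 [Balaban1985RegularSpaces] = cell paper B8, DAG node **N05**: the leaf SHAPE
# `B8LeafRSC` = n05-a's re-typed faithful leaf `B8LeafKnitRS.B8LeafRS` with conjunct `p7` read in the REPAIRED-CONSTANT currency
# `B8Ineq145.Prop7RepairedC C₇` ((1.145) «|Ū′U₀ʲ − Ū₀ʲ| < C₇·α₂ on Λ_j» — print's `2α₂` is `C₇ = 2`) instead of `B8SectGH.Prop7PrintedR`;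
# OLD ⇒ NEW for `C₇ ≥ 2`, monotonicity in `C₇`, and NEW ⇒ OLD only for `C₇ ≤ 2` (additive sibling; nothing of `B8LeafKnitRS` is edited)

statement-level skeleton of published theorems with citation tags; ONE structure + bookkeeping; nothing here is a claim about the Yang–Mills mass gap

CITATION HEADER (lean-in-tree rule).  Cell `pub-ymgap` (YM-PLAN Track A, HUMAN RULING D-0062), DAG node N05 = [B8], seat `pub-ymgap-dag-n05-d` (g11;
the row's -d lane), 2026-08-28; definition lane, count-neutral.  PDF held: `paper:balaban1985-cmp99-regular-spaces-gauge-fixing` (journal page = PDF page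
+ 74): Prop. 7 (1.143)–(1.145) p. 100 («The Proposition 4 from [3] gives also |Q_j(U₀,ηA)| < 2α₂ on Ω_j. … Proposition 7. If the configurations U₀, A
satisfy (1.139), (1.140), then for α₀, α₂ sufficiently small we have (1.144) (1.145)»), (1.35) p. 82, (1.4) p. 77, Lemma 1 – Thm 8 pp. 79–101.

WHY THIS FILE (cell bus 2026-08-28: this seat's DESIGN «P₂C» 03:12Z; dag-n05-w1 WORD-P₂C «YES + amendment (i); leaf shape: n05-a lineage's or yours» 03:13Z;
dag-n05-e ACK-4).  NODE 00's [B8] slot of record `Node00.CarriersB8SubBP.B8LeafOfRecordSubBP θ λ` reads `B8LeafRS`, whose conjunct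
`p7 : B8SectGH.Prop7PrintedR fam toAxial` carries print's constant `2α₂`.  The tree's ONLY supplier of Proposition 7 at NODE 00's nested `Ω₀ = ℤᵈ` law members
(dag-n05-w1's `B8Prop7TowerAxialCollarP` ∕ `B8Prop7TowerAxialRecordP`, dag-n05-w2's one-level-up edition) concludes `B8Ineq145.Prop7RepairedC (530·d·L²) …` on
the members obeying print's (1.4) collar law — the honest constant of the tree's edge-bond estimate (a level-`j` bond with one end block outside `Ω_j` has only
level-`(j−1)` control of `A`; print's «2α₂» quotes [3] Prop. 4 for the LINEAR average `Q_j(U₀,ηA)` «on Ω_j»).  `Prop7RepairedC C → Prop7PrintedR` needs `C ≤ 2`,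
so no bridge serves the slot's `p7` as typed.  The re-pin of record «P₂C» (one re-pin for the located narrownesses №4 Hölder class ∕ collar index ∕ Prop-7
currency ∕ pinned axial map) therefore reads Proposition 7 in the `Prop7RepairedC C₇` currency with the literal `C₇ := 530·θ.D·θ.L²` in the slot; THIS FILE types
that leaf shape, ADDITIVELY (n05-a's `B8LeafRS`, `Upstream.ofPrintedAllXPNS` and every NODE 00 binding untouched; which leaf NODE 00 binds is node00-def's ∕ the
planners' decision — dag-n05-w1 types the pin `Node00/CarriersB8SubBP2C` on this shape).

WHAT THIS FILE TYPES AND PROVES (0 sorry; axioms standard; 1 structure; theorems otherwise).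
§1 `B8LeafRSC d L C₂ B₁′ B₀′ B₁ B₂ c₁ inp B₀β C₇ loc fam lan cub toAxial` — `B8LeafRS`'s nine conjuncts with the SAME parameters and carriers, `l1 t2 p3 t4 p5e p5u p6 t8`
   VERBATIM by name (`B8.Lemma1Printed`, `B8.Thm2Printed`, `B8.Prop3Printed`, `B8.Thm4Printed`, `B8.Prop5Exists`, `B8.Prop5Unique`, `B8.Prop6Printed`,
   `B8Thm8Surviving.Thm8SurvivingAt 1`) and `p7 := B8Ineq145.Prop7RepairedC C₇ fam toAxial`; `b8LeafRSC_iff` bookkeeping.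
§2 `b8LeafRSC_of_b8LeafRS` — OLD ⇒ NEW for every `C₇ ≥ 2` under the displayed carrier law «(1.35) is monotone in its constant» (`hmono`; `rfl`-true by `le_trans` in
   every honest instance) — `B8Ineq145.prop7RepairedC_of_printedR`; `B8LeafRSC.mono` — monotone in `C₇` (`prop7RepairedC_mono`); `b8LeafRS_of_b8LeafRSC_of_le_two` —
   NEW ⇒ OLD only when `C₇ ≤ 2` (then `C₇·α₂ ≤ 2α₂`); no other converse is claimed.
§3 (v1.1) `B8LeafRSC.withP6` — re-pointing the Proposition-6 conjunct `(c₁, cub) ↦ (c₁′, cub′)` given `Prop6Printed … c₁′ cub′` (the other eight conjuncts read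
   neither); the leaf-shape form of k0-s2-w2's threshold-zero device ∕ dag-n05-e's transfer with threshold change.

HONEST SCOPE ∕ NOT CLAIMED.  TYPING + BOOKKEEPING ONLY, count-neutral: no conjunct is proved here; NOT a discharge of N05.  The constant `C₇` is DISPLAYED — print's
sentence is `C₇ = 2`; the tree's suppliers give `530·d·L²` (sufficient, not optimal); the leaf with `C₇ > 2` asks LESS than print's Proposition 7 as typed and says so.
One finite four-torus programme at fixed ε, Bałaban AS PRINTED with locators; nothing continuum ∕ ℝ⁴ ∕ OS ∕ mass gap ∕ Clay.  No `sorry`, no `instance`, no `notation`.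
Unit `pub-ymgap-dag-n05-d` (g11), 2026-08-28.
-/

namespace Literature.MathematicalPhysics.QuantumFieldTheory.Balaban1983to89.B8LeafKnitRSC

open DagBinding B8LeafKnitRS B8Ineq145

/-! ## §1 The leaf shape `B8LeafRSC`: Proposition 7 in the repaired-constant currency -/

section Leaf

/-- **The faithful B8 leaf with Theorem 8 in its surviving form AND Proposition 7 in the repaired-constant currency**: n05-a's `B8LeafKnitRS.B8LeafRS`
(Lemma 1 p. 79, Thm 2 p. 83, Prop 3 p. 87, Thm 4 p. 88, Prop 5 p. 94 both halves, Prop 6 p. 99, Thm 8 p. 101 surviving form — BY NAME, unchanged, same parameters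
and carriers) with conjunct `p7 := B8Ineq145.Prop7RepairedC C₇ fam toAxial` — Proposition 7 p. 100 with (1.145) read «|Ū′U₀ʲ − Ū₀ʲ| < C₇·α₂ on Λ_j» (the carrier's
(1.35) letter `avgClose (C₇·α₂)`), (1.144) verbatim; print's sentence is `C₇ = 2` (`B8SectGH.Prop7PrintedR`).  The constant `C₇` is a DISPLAYED parameter of the leaf
(NODE 00's pin fixes its literal). [cite: Balaban1985RegularSpaces, Lemma 1 – Thm 8 pp.79–101; Prop. 7 (1.144)–(1.145) p.100 (repaired-constant currency, audit G-adv8-16)] -/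
structure B8LeafRSC {I₁ I₂ I₃ I₄ : Type} (d : ℕ) (L C₂ B₁' B₀' B₁ B₂ c₁ : ℝ) (inp : B8.B9Inputs) (B₀β C₇ : ℝ)
    (loc : I₁ → B8.LocalData) (fam : I₂ → B8SectGH.GFData3) (lan : I₃ → B8.LandauData)
    (cub : I₄ → B8.CubeData) (toAxial : ∀ i, (fam i).Cfg → (fam i).Pert → (fam i).Pert) : Prop where
  l1 : B8.Lemma1Printed d loc
  t2 : B8.Thm2Printed (fun i => (fam i).toGFData)
  p3 : B8.Prop3Printed d L C₂ inp B₀β (fun i => (fam i).toGFData2)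
  t4 : B8.Thm4Printed B₁' (fun i => (fam i).toGFData)
  p5e : B8.Prop5Exists B₀' B₁ lan
  p5u : B8.Prop5Unique lan
  p6 : B8.Prop6Printed d L B₁ c₁ cub
  p7 : B8Ineq145.Prop7RepairedC C₇ fam toAxial
  t8 : B8Thm8Surviving.Thm8SurvivingAt 1 B₁ B₂ fam

variable {I₁ I₂ I₃ I₄ : Type} {d : ℕ} {L C₂ B₁' B₀' B₁ B₂ c₁ : ℝ} {inp : B8.B9Inputs} {B₀β C₇ C₇' : ℝ}
  {loc : I₁ → B8.LocalData} {fam : I₂ → B8SectGH.GFData3} {lan : I₃ → B8.LandauData} {cub : I₄ → B8.CubeData}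
  {toAxial : ∀ i, (fam i).Cfg → (fam i).Pert → (fam i).Pert}

variable (d L C₂ B₁' B₀' B₁ B₂ c₁ inp B₀β C₇ loc fam lan cub toAxial) in
/-- The leaf unfolded (`Iff` by constructor∕projections): nine named printed statements, Proposition 7 in the `C₇` currency.
[cite: Balaban1985RegularSpaces, Lemma 1 – Thm 8 pp.79–101 (bookkeeping)] -/
theorem b8LeafRSC_iff :
    B8LeafRSC d L C₂ B₁' B₀' B₁ B₂ c₁ inp B₀β C₇ loc fam lan cub toAxial ↔
      B8.Lemma1Printed d loc ∧ B8.Thm2Printed (fun i => (fam i).toGFData) ∧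
      B8.Prop3Printed d L C₂ inp B₀β (fun i => (fam i).toGFData2) ∧ B8.Thm4Printed B₁' (fun i => (fam i).toGFData) ∧
      B8.Prop5Exists B₀' B₁ lan ∧ B8.Prop5Unique lan ∧ B8.Prop6Printed d L B₁ c₁ cub ∧ B8Ineq145.Prop7RepairedC C₇ fam toAxial ∧
      B8Thm8Surviving.Thm8SurvivingAt 1 B₁ B₂ fam :=
  ⟨fun h => ⟨h.l1, h.t2, h.p3, h.t4, h.p5e, h.p5u, h.p6, h.p7, h.t8⟩,
    fun ⟨l1, t2, p3, t4, p5e, p5u, p6, p7, t8⟩ => ⟨l1, t2, p3, t4, p5e, p5u, p6, p7, t8⟩⟩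

end Leaf

/-! ## §2 OLD ⇒ NEW (`C₇ ≥ 2`), monotonicity in `C₇`, and NEW ⇒ OLD for `C₇ ≤ 2` -/

section Bridges

variable {I₁ I₂ I₃ I₄ : Type} {d : ℕ} {L C₂ B₁' B₀' B₁ B₂ c₁ : ℝ} {inp : B8.B9Inputs} {B₀β C₇ C₇' : ℝ}
  {loc : I₁ → B8.LocalData} {fam : I₂ → B8SectGH.GFData3} {lan : I₃ → B8.LandauData} {cub : I₄ → B8.CubeData}
  {toAxial : ∀ i, (fam i).Cfg → (fam i).Pert → (fam i).Pert}

/-- **OLD ⇒ NEW**: n05-a's leaf `B8LeafRS` (Proposition 7 with print's `2α₂`) implies the `C₇`-currency leaf for every `C₇ ≥ 2`, under the displayed carrier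
law «(1.35) `avgClose` is monotone in its constant» (`hmono`; `le_trans` in every honest instance) — `B8Ineq145.prop7RepairedC_of_printedR`; the other eight
conjuncts verbatim.  The converse holds only for `C₇ ≤ 2` (below). [cite: Balaban1985RegularSpaces, Prop. 7 (1.144)–(1.145) p.100 (bookkeeping)] -/
theorem b8LeafRSC_of_b8LeafRS (hC : 2 ≤ C₇)
    (hmono : ∀ i (a a' : ℝ) (U₀ : (fam i).Cfg) (U' : (fam i).Pert), a ≤ a' → (fam i).avgClose a U₀ U' → (fam i).avgClose a' U₀ U')
    (h : B8LeafRS d L C₂ B₁' B₀' B₁ B₂ c₁ inp B₀β loc fam lan cub toAxial) :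
    B8LeafRSC d L C₂ B₁' B₀' B₁ B₂ c₁ inp B₀β C₇ loc fam lan cub toAxial where
  l1 := h.l1
  t2 := h.t2
  p3 := h.p3
  t4 := h.t4
  p5e := h.p5e
  p5u := h.p5u
  p6 := h.p6
  p7 := prop7RepairedC_of_printedR C₇ hC fam toAxial hmono h.p7
  t8 := h.t8

/-- **Monotone in `C₇`**: a larger constant asks less ((1.35) monotone in its constant, displayed as `hmono`) — `B8Ineq145.prop7RepairedC_mono`.
[cite: Balaban1985RegularSpaces, Prop. 7 (1.145) p.100 (bookkeeping)] -/
theorem B8LeafRSC.mono (hCC' : C₇ ≤ C₇')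
    (hmono : ∀ i (a a' : ℝ) (U₀ : (fam i).Cfg) (U' : (fam i).Pert), a ≤ a' → (fam i).avgClose a U₀ U' → (fam i).avgClose a' U₀ U')
    (h : B8LeafRSC d L C₂ B₁' B₀' B₁ B₂ c₁ inp B₀β C₇ loc fam lan cub toAxial) :
    B8LeafRSC d L C₂ B₁' B₀' B₁ B₂ c₁ inp B₀β C₇' loc fam lan cub toAxial where
  l1 := h.l1
  t2 := h.t2
  p3 := h.p3
  t4 := h.t4
  p5e := h.p5e
  p5u := h.p5u
  p6 := h.p6
  p7 := prop7RepairedC_mono hCC' fam toAxial hmono h.p7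
  t8 := h.t8

/-- **NEW ⇒ OLD only for `C₇ ≤ 2`**: when the displayed constant is at most print's, the `C₇`-currency leaf gives back n05-a's `B8LeafRS` (`C₇·α₂ ≤ 2α₂`, `hmono`).
No converse is claimed for `C₇ > 2` — the tree's suppliers give `C₇ = 530·d·L²`. [cite: Balaban1985RegularSpaces, Prop. 7 (1.145) p.100 (bookkeeping)] -/
theorem b8LeafRS_of_b8LeafRSC_of_le_two (hC : C₇ ≤ 2)
    (hmono : ∀ i (a a' : ℝ) (U₀ : (fam i).Cfg) (U' : (fam i).Pert), a ≤ a' → (fam i).avgClose a U₀ U' → (fam i).avgClose a' U₀ U')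
    (h : B8LeafRSC d L C₂ B₁' B₀' B₁ B₂ c₁ inp B₀β C₇ loc fam lan cub toAxial) :
    B8LeafRS d L C₂ B₁' B₀' B₁ B₂ c₁ inp B₀β loc fam lan cub toAxial where
  l1 := h.l1
  t2 := h.t2
  p3 := h.p3
  t4 := h.t4
  p5e := h.p5e
  p5u := h.p5u
  p6 := h.p6
  p7 := by
    obtain ⟨c, hc, H⟩ := h.p7
    refine ⟨c, hc, fun i α₀ α₂ h₀ h₀c h₂ h₂c U₀ U₁ hA h140 => ?_⟩
    obtain ⟨hax, hcl⟩ := H i α₀ α₂ h₀ h₀c h₂ h₂c U₀ U₁ hA h140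
    exact ⟨hax, hmono i _ _ U₀ _ (mul_le_mul_of_nonneg_right hC h₂.le) hcl⟩
  t8 := h.t8

end Bridges

/-! ## §3 (v1.1) Re-pointing the Proposition-6 conjunct: the threshold `c₁` and the cube family `cub` are read by `p6` ONLY -/

section WithP6

variable {I₁ I₂ I₃ I₄ I₄' : Type} {d : ℕ} {L C₂ B₁' B₀' B₁ B₂ c₁ c₁' : ℝ} {inp : B8.B9Inputs} {B₀β C₇ : ℝ}
  {loc : I₁ → B8.LocalData} {fam : I₂ → B8SectGH.GFData3} {lan : I₃ → B8.LandauData} {cub : I₄ → B8.CubeData} {cub' : I₄' → B8.CubeData}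
  {toAxial : ∀ i, (fam i).Cfg → (fam i).Pert → (fam i).Pert}

/-- **(v1.1) RE-POINTING PROPOSITION 6** (k0-s2-w2's threshold-zero device ∕ dag-n05-e's transfer with threshold change, at the leaf-shape level): the eight
conjuncts other than `p6` read neither the threshold `c₁` nor the cube family `cub`, so a leaf at `(c₁, cub)` plus Proposition 6 at `(c₁′, cub′)` is the leaf at
`(c₁′, cub′)`.  With `c₁ := 0` the source leaf needs no genuine Proposition-6 input (the typed conjunct is vacuous at a non-positive threshold,
`B8LeafOfRecordSubBPCutPFields8.prop6Printed_zdCub_of_nonpos`), and `p6` is then SUPPLIED on print's p. 98 cube class by `B8Prop6PrintedZdCubPGamma` (p596570).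
[cite: Balaban1985RegularSpaces, Prop. 6 (1.135)–(1.138) p.99, p.98, Thm 2 p.83 («There exist constants B₁, B₂(β₀), c₁») (bookkeeping)] -/
theorem B8LeafRSC.withP6 (h : B8LeafRSC d L C₂ B₁' B₀' B₁ B₂ c₁ inp B₀β C₇ loc fam lan cub toAxial)
    (p6 : B8.Prop6Printed d L B₁ c₁' cub') : B8LeafRSC d L C₂ B₁' B₀' B₁ B₂ c₁' inp B₀β C₇ loc fam lan cub' toAxial where
  l1 := h.l1
  t2 := h.t2
  p3 := h.p3
  t4 := h.t4
  p5e := h.p5e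
  p5u := h.p5u
  p6 := p6
  p7 := h.p7
  t8 := h.t8

end WithP6

end Literature.MathematicalPhysics.QuantumFieldTheory.Balaban1983to89.B8LeafKnitRSC
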